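import Summits.QuantumFields.YangMills.Theorems.AtomicSynthesisWeightedOneStep
import Summits.QuantumFields.YangMills.Theorems.AtomicSynthesisTensorisation

/-!
# Weighted atomic synthesis (for the tempered E3T stub of leaf 19868), part 4: weighted tensorisation —
`n`-slot atomic synthesis with the WEIGHTED mass `Σ_i |coef_i| ∏_l (ρ/σ_il)^K ≤ Cⁿ M`

Free-hands helper toward the registered stub E3T `stub_temperedMomentBoundA` of LINES «TemperedPeak» REV 2 /
«OctaveDoubling» REV 2.1 on the leaf `InfiniteVolumeContinuum.HypercubicOSDataFromInfiniteVolume` (stmt-QuantumFields-19868).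
Twin of the landed tensorisation `AtomicSynthesisTensor.synthFor_of_slotSynth` (crux AtomicSynthesis 28126) with the
slot weights carried: the product Fourier expansion of the `n`-slot function (landed `fourier_transport`, `prod_majorant`),
each slot factor synthesised by WEIGHTED single-slot synthesis (`SlotSynthW`, parts 1–3; `slot_hasSum_atomsW`), the
weighted slot costs MULTIPLY over the slots and the frequency sum factorises exactly as in the unweighted case — whence
`atomicSynthesisW`: for every compactly supported Schwartz bump `b` with `∫ b ≠ 0` and every weight exponent `K` there are
`C, N` with the crux's `n`-slot conclusion PLUS `Σ_i |coef_i| ∏_l (ρ/σ_il)^K ≤ Cⁿ M`.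
Pure approximation theory; no stub/crux/rung/summit is closed by this file; the YM mass gap is NOT proved. [folklore]
-/

noncomputable section

open Set Function Filter Topology MeasureTheory Complex
open Literature.Analysis.FunctionSpaces
open Literature.MathematicalPhysics.QuantumLattice (eChar absSum absSum_nonneg abs_le_absSum)
open Summit.QuantumFields.YangMills.Cruxes.AtomicSynthesis.SingleSlotPlan (E4)
open Summit.QuantumFields.YangMills.Theorems.AtomicSynthesisTensor
open scoped ContDiff Real

namespace Summit.QuantumFields.YangMills.Theorems.AtomicSynthesisWeighted

/-! ## §1 Weighted slot synthesis of the Fourier slot factors -/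

/-- From weighted to unweighted absolute summability (the weights are `≥ 1`). [folklore] -/
theorem summable_abs_of_weighted {a σ : ℕ → ℝ} {ρ : ℝ} {K : ℕ}
    (hw : Summable (fun i => |a i| * (ρ / σ i) ^ K)) (hσ : ∀ i, 0 < σ i ∧ σ i ≤ ρ) :
    Summable (fun i => |a i|) ∧ ∑' i, |a i| ≤ ∑' i, |a i| * (ρ / σ i) ^ K := by
  have hle : ∀ i, |a i| ≤ |a i| * (ρ / σ i) ^ K := fun i =>
    le_mul_of_one_le_right (abs_nonneg _) (one_le_pow₀ ((one_le_div (hσ i).1).2 (hσ i).2))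
  have hs : Summable (fun i => |a i|) := Summable.of_nonneg_of_le (fun i => abs_nonneg _) hle hw
  exact ⟨hs, hs.tsum_le_tsum hle hw⟩

/-- **Weighted slot synthesis.**  Under `SlotSynthW b C₁ N₁ K`, a bump `χ` with `χ.rOut = 3/2` and derivative bounds
`‖D^i χ‖ ≤ B` (`i ≤ N₁`): for every `κ ∈ ℤ⁴`, centre `c`, offset `h` and `ρ > 0` the slot function
`Θ(w) = χ(ρ⁻¹(w − c)) e_κ(4⁻¹ρ⁻¹(w − c) + h)` is an absolutely convergent complex series of `b`-atoms with
`0 < σ_ι ≤ ρ`, `‖η_ι − c‖ ≤ 2ρ` and WEIGHTED mass `∑_ι ‖A_ι‖ (ρ/σ_ι)^K ≤ 2 C₁ B (1 + (π/2)|κ|₁)^{N₁}`. [folklore] -/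
theorem slot_hasSum_atomsW {b : SchwartzMap (EuclideanSpace ℝ (Fin 4)) ℝ} {C₁ : ℝ} {N₁ K : ℕ}
    (hS : SlotSynthW b C₁ N₁ K) (χ : ContDiffBump (0 : EuclideanSpace ℝ (Fin 4))) (hχ : χ.rOut = 3 / 2) {B : ℝ}
    (hB : ∀ i, i ≤ N₁ → ∀ y, ‖iteratedFDeriv ℝ i (fun y => χ y) y‖ ≤ B) (κ : Fin 4 → ℤ)
    (h c : EuclideanSpace ℝ (Fin 4)) {ρ : ℝ} (hρ : 0 < ρ) :
    ∃ (A : ℕ ⊕ ℕ → ℂ) (σ : ℕ ⊕ ℕ → ℝ) (η : ℕ ⊕ ℕ → EuclideanSpace ℝ (Fin 4)),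
      Summable (fun i => ‖A i‖) ∧ Summable (fun i => ‖A i‖ * (ρ / σ i) ^ K) ∧
      ∑' i, ‖A i‖ * (ρ / σ i) ^ K ≤ 2 * C₁ * (B * (1 + π / 2 * absSum κ) ^ N₁) ∧
      (∀ i, 0 < σ i ∧ σ i ≤ ρ ∧ ‖η i - c‖ ≤ 2 * ρ) ∧
      ∀ w, HasSum (fun i => A i * (b ((σ i)⁻¹ • (w - η i)) : ℂ))
        (χ (ρ⁻¹ • (w - c)) • eChar κ ((4 : ℝ)⁻¹ • (ρ⁻¹ • (w - c)) + h)) := by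
  set Θ : EuclideanSpace ℝ (Fin 4) → ℂ :=
    fun w => χ (ρ⁻¹ • (w - c)) • eChar κ ((4 : ℝ)⁻¹ • (ρ⁻¹ • (w - c)) + h) with hΘdef
  set M' : ℝ := B * (1 + π / 2 * absSum κ) ^ N₁ with hM'
  have hΘ : ContDiff ℝ ∞ Θ := contDiff_slot χ κ h c ρ
  have hcs : HasCompactSupport Θ := hasCompactSupport_slot χ hχ κ h c hρ
  have hts : tsupport Θ ⊆ Metric.closedBall c (3 / 2 * ρ) := tsupport_slot_subset χ hχ κ h c hρ
  have hder : ∀ m, m ≤ N₁ → ∀ w, ‖iteratedFDeriv ℝ m Θ w‖ ≤ M' / ρ ^ m :=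
    fun m hm w => norm_iteratedFDeriv_slot_le χ hB κ h c hρ hm w
  -- real and imaginary parts as Schwartz functions
  obtain ⟨hre_sm, hre_cs, hre_ts, hre_der⟩ := clm_comp_slot_props hΘ hcs reCLM (le_of_eq reCLM_norm)
  obtain ⟨him_sm, him_cs, him_ts, him_der⟩ := clm_comp_slot_props hΘ hcs imCLM (le_of_eq imCLM_norm)
  obtain ⟨ar, σr, ηr, har_w, har_le, hr_geo, hr_eq⟩ := hS (hre_cs.toSchwartzMap hre_sm) c ρ M' hρ
    (hre_ts.trans hts) (fun m hm z => (hre_der m z).trans (hder m hm z))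
  obtain ⟨ai, σi, ηi, hai_w, hai_le, hi_geo, hi_eq⟩ := hS (him_cs.toSchwartzMap him_sm) c ρ M' hρ
    (him_ts.trans hts) (fun m hm z => (him_der m z).trans (hder m hm z))
  have har_sum := (summable_abs_of_weighted har_w (fun i => ⟨(hr_geo i).1, (hr_geo i).2.1⟩)).1
  have hai_sum := (summable_abs_of_weighted hai_w (fun i => ⟨(hi_geo i).1, (hi_geo i).2.1⟩)).1
  -- the interleaved complex series
  refine ⟨Sum.elim (fun i => (ar i : ℂ)) (fun i => (ai i : ℂ) * I), Sum.elim σr σi, Sum.elim ηr ηi,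
    ?_, ?_, ?_, ?_, fun w => ?_⟩
  · refine Summable.sum _ ?_ ?_
    · simpa [Function.comp_def] using har_sum
    · simpa [Function.comp_def] using hai_sum
  · refine Summable.sum _ ?_ ?_
    · simpa [Function.comp_def] using har_w
    · simpa [Function.comp_def] using hai_w
  · have h1 : Summable fun i => ‖Sum.elim (fun i => (ar i : ℂ)) (fun i => (ai i : ℂ) * I) (Sum.inl i)‖ *
        (ρ / Sum.elim σr σi (Sum.inl i)) ^ K := by
      simpa using har_w
    have h2 : Summable fun i => ‖Sum.elim (fun i => (ar i : ℂ)) (fun i => (ai i : ℂ) * I) (Sum.inr i)‖ *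
        (ρ / Sum.elim σr σi (Sum.inr i)) ^ K := by
      simpa using hai_w
    rw [Summable.tsum_sum (f := fun i => ‖Sum.elim (fun i => (ar i : ℂ)) (fun i => (ai i : ℂ) * I) i‖ *
        (ρ / Sum.elim σr σi i) ^ K)
      (by simpa [Function.comp_def] using h1) (by simpa [Function.comp_def] using h2)]
    simp only [Sum.elim_inl, Sum.elim_inr, Complex.norm_real, Real.norm_eq_abs, norm_mul, Complex.norm_I,
      mul_one]
    linarith
  · rintro (i | i)
    · exact hr_geo i
    · exact hi_geo i
  · have hr := hasSum_ofReal_atoms b har_sum σr ηr hr_eq w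
    have hi := (hasSum_ofReal_atoms b hai_sum σi ηi hi_eq w).mul_right I
    have hsum := HasSum.sum (f := fun i : ℕ ⊕ ℕ =>
        Sum.elim (fun i => (ar i : ℂ)) (fun i => (ai i : ℂ) * I) i *
          (b ((Sum.elim σr σi i)⁻¹ • (w - Sum.elim ηr ηi i)) : ℂ))
      (by simpa [Function.comp_def] using hr)
      (by simpa [Function.comp_def, mul_right_comm] using hi)
    have hval : (((Θ w).re : ℝ) : ℂ) + (((Θ w).im : ℝ) : ℂ) * I = Θ w := re_add_im _
    rw [hval] at hsum
    exact hsum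

/-! ## §2 Weighted tensorisation -/

/-- **Weighted tensorisation.**  Weighted single-slot synthesis with constants `C₁, N₁, K` gives the `n`-slot synthesis
of crux 28126 for `b` together with the WEIGHTED mass bound `Σ_i |coef_i| ∏_l (ρ/σ_il)^K ≤ Cⁿ M`, `C = 2 C₁ B U⁴`,
`N = 4(N₁+2)`. [folklore] -/
theorem synthW_of_slotSynthW (b : SchwartzMap E4 ℝ) (C₁ : ℝ) (N₁ K : ℕ) (hC₁ : 0 ≤ C₁)
    (hS : SlotSynthW b C₁ N₁ K) :
    ∃ (C : ℝ) (N : ℕ), 0 ≤ C ∧ ∀ (n : ℕ), 1 ≤ n →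
      ∀ (F : SchwartzMap (Fin n → EuclideanSpace ℝ (Fin 4)) ℝ) (c : Fin n → EuclideanSpace ℝ (Fin 4))
        (ρ M : ℝ), 0 < ρ → tsupport F ⊆ {z | ∀ l, ‖z l - c l‖ ≤ ρ} →
        (∀ m : ℕ, m ≤ N * n → ∀ z, ‖iteratedFDeriv ℝ m F z‖ ≤ M / ρ ^ m) →
        ∃ (coef : ℕ → ℝ) (σ : ℕ → Fin n → ℝ) (η : ℕ → Fin n → EuclideanSpace ℝ (Fin 4)),
          Summable (fun i => |coef i|) ∧ Summable (fun i => |coef i| * ∏ l, (ρ / σ i l) ^ K) ∧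
          ∑' i, |coef i| * ∏ l, (ρ / σ i l) ^ K ≤ C ^ n * M ∧
          (∀ i l, 0 < σ i l ∧ σ i l ≤ ρ ∧ ‖η i l - c l‖ ≤ 2 * ρ) ∧
          ∀ z, F z = ∑' i, coef i * ∏ l, b ((σ i l)⁻¹ • (z l - η i l)) := by
  -- the cutoff and its derivative bounds
  let χ : ContDiffBump (0 : EuclideanSpace ℝ (Fin 4)) := ⟨1, 3 / 2, by norm_num, by norm_num⟩
  have hχin : χ.rIn = 1 := rfl
  have hχout : χ.rOut = 3 / 2 := rfl
  obtain ⟨B, hB0, hB⟩ := Torus.exists_bound_iteratedFDeriv_bump χ N₁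
  -- the weights
  set u : ℤ → ℝ := fun m => (1 + 2 * |(m : ℝ)|) ^ N₁ * ((max 1 |(m : ℝ)|) ^ (N₁ + 2))⁻¹ with hu
  have hu0 : ∀ m, 0 ≤ u m := fun m => by positivity
  have hus : Summable u := summable_weight N₁
  set U : ℝ := ∑' m, u m with hU
  have hU0 : 0 ≤ U := tsum_nonneg hu0
  -- the bound of `b`
  obtain ⟨Bb, hBb0, hBb⟩ := exists_bound_schwartz b
  refine ⟨2 * C₁ * B * U ^ 4, 4 * (N₁ + 2), by positivity, ?_⟩
  intro n hn F c ρ M hρ hsupp hder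
  have hM0 : 0 ≤ M := by
    have := hder 0 (Nat.zero_le _) c
    rw [pow_zero, div_one] at this
    exact (norm_nonneg _).trans this
  -- (1) the product Fourier expansion
  obtain ⟨G, hGs, hG0, hGdec, hGexp⟩ := fourier_transport F c hρ (K := 4 * (N₁ + 2) * n) hsupp hder
  have hGw : ∀ k : Fin n × Fin 4 → ℤ, ‖G k‖ ≤ M * ∏ p, ((max 1 |(k p : ℝ)|) ^ (N₁ + 2))⁻¹ := by
    intro k
    refine prod_majorant k (N₁ + 2) (m := 4 * (N₁ + 2) * n) ?_ (norm_nonneg _) (hG0 k)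
      (fun p hp => hGdec k p hp _ le_rfl)
    rw [Fintype.card_prod, Fintype.card_fin, Fintype.card_fin]; ring
  -- (2) the weighted slot syntheses
  set hhalf : EuclideanSpace ℝ (Fin 4) := WithLp.toLp 2 (fun _ : Fin 4 => (1 / 2 : ℝ)) with hhalf_def
  choose A σ η hAs hAw hAle hgeo hAsum using fun (k : Fin n × Fin 4 → ℤ) (l : Fin n) =>
    slot_hasSum_atomsW hS χ hχout hB (fun j => k (l, j)) hhalf (c l) hρ
  -- the weighted slot norms `v k l i = ‖A k l i‖ (ρ/σ k l i)^K ≥ ‖A k l i‖`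
  set v : (Fin n × Fin 4 → ℤ) → Fin n → ℕ ⊕ ℕ → ℝ := fun k l i => ‖A k l i‖ * (ρ / σ k l i) ^ K with hv
  have hv0 : ∀ k l i, 0 ≤ v k l i := fun k l i =>
    mul_nonneg (norm_nonneg _) (pow_nonneg (div_nonneg hρ.le (hgeo k l i).1.le) K)
  have hwge : ∀ k l i, 1 ≤ (ρ / σ k l i) ^ K := fun k l i =>
    one_le_pow₀ ((one_le_div (hgeo k l i).1).2 (hgeo k l i).2.1)
  -- per-slot weighted cost in product form
  have hAcost : ∀ (k : Fin n × Fin 4 → ℤ) (l : Fin n),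
      ∑' i, v k l i ≤ 2 * C₁ * B * ∏ j, (1 + 2 * |(k (l, j) : ℝ)|) ^ N₁ := by
    intro k l
    refine (hAle k l).trans ?_
    rw [show 2 * C₁ * (B * (1 + π / 2 * absSum (fun j => k (l, j))) ^ N₁) =
      2 * C₁ * B * (1 + π / 2 * absSum (fun j => k (l, j))) ^ N₁ by ring]
    exact mul_le_mul_of_nonneg_left (slot_cost_le_prod _ N₁) (by positivity)
  -- (3) the total coefficient family on `J = ℤ^{n×4} × (ℕ ⊕ ℕ)ⁿ` and its weights
  set W : (Fin n × Fin 4 → ℤ) × (Fin n → ℕ ⊕ ℕ) → ℂ := fun j => G j.1 * ∏ l, A j.1 l (j.2 l) with hW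
  set wt : (Fin n × Fin 4 → ℤ) × (Fin n → ℕ ⊕ ℕ) → ℝ := fun j => ∏ l, (ρ / σ j.1 l (j.2 l)) ^ K with hwt
  set β : (Fin n × Fin 4 → ℤ) × (Fin n → ℕ ⊕ ℕ) → (Fin n → EuclideanSpace ℝ (Fin 4)) → ℝ :=
    fun j z => ∏ l, b ((σ j.1 l (j.2 l))⁻¹ • (z l - η j.1 l (j.2 l))) with hβ
  have hwt1 : ∀ j, 1 ≤ wt j := fun j => by
    rw [hwt]
    exact Finset.one_le_prod (f := fun l => (ρ / σ j.1 l (j.2 l)) ^ K) fun l _ => hwge _ _ _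
  have hWwt : ∀ j, ‖W j‖ * wt j = ‖G j.1‖ * ∏ l, v j.1 l (j.2 l) := by
    intro j
    simp only [hW, hwt, hv, norm_mul, norm_prod, Finset.prod_mul_distrib]
    ring
  -- fibrewise weighted ℓ¹ norms
  have hWk : ∀ k, Summable (fun ι : Fin n → ℕ ⊕ ℕ => ‖W (k, ι)‖ * wt (k, ι)) ∧
      ∑' ι : Fin n → ℕ ⊕ ℕ, ‖W (k, ι)‖ * wt (k, ι) = ‖G k‖ * ∏ l, ∑' i, v k l i := by
    intro k
    obtain ⟨h1, h2⟩ := summable_prod_pi_of_nonneg (fun l i => v k l i) (fun l i => hv0 k l i) (fun l => hAw k l)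
    refine ⟨?_, ?_⟩
    · simp_rw [hWwt]
      exact h1.mul_left ‖G k‖
    · simp_rw [hWwt]
      rw [tsum_mul_left, h2]
  have hcostk : ∀ k : Fin n × Fin 4 → ℤ,
      ‖G k‖ * ∏ l, ∑' i, v k l i ≤ M * (2 * C₁ * B) ^ n * ∏ p, u (k p) := by
    intro k
    have h1 : ∏ l, ∑' i, v k l i ≤ ∏ l, (2 * C₁ * B * ∏ j, (1 + 2 * |(k (l, j) : ℝ)|) ^ N₁) :=
      Finset.prod_le_prod (fun l _ => tsum_nonneg fun i => hv0 k l i) fun l _ => hAcost k l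
    have h2 : ∏ l, (2 * C₁ * B * ∏ j, (1 + 2 * |(k (l, j) : ℝ)|) ^ N₁) =
        (2 * C₁ * B) ^ n * ∏ p : Fin n × Fin 4, (1 + 2 * |(k p : ℝ)|) ^ N₁ := by
      rw [Finset.prod_mul_distrib, Finset.prod_const, Finset.card_univ, Fintype.card_fin, Fintype.prod_prod_type]
    rw [h2] at h1
    calc ‖G k‖ * ∏ l, ∑' i, v k l i
        ≤ (M * ∏ p, ((max 1 |(k p : ℝ)|) ^ (N₁ + 2))⁻¹) *
            ((2 * C₁ * B) ^ n * ∏ p : Fin n × Fin 4, (1 + 2 * |(k p : ℝ)|) ^ N₁) :=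
          mul_le_mul (hGw k) h1 (Finset.prod_nonneg fun l _ => tsum_nonneg fun i => hv0 k l i) (by positivity)
      _ = M * (2 * C₁ * B) ^ n * ∏ p, u (k p) := by
          simp only [hu]
          rw [Finset.prod_mul_distrib]
          ring
  have hmaj : Summable fun k : Fin n × Fin 4 → ℤ => M * (2 * C₁ * B) ^ n * ∏ p, u (k p) :=
    (summable_prod_pi_of_nonneg (fun (_ : Fin n × Fin 4) m => u m) (fun _ m => hu0 m) (fun _ => hus)).1.mul_left _
  have hWwsum : Summable (fun j : (Fin n × Fin 4 → ℤ) × (Fin n → ℕ ⊕ ℕ) => ‖W j‖ * wt j) := by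
    refine (summable_prod_of_nonneg (fun j => mul_nonneg (norm_nonneg _) (zero_le_one.trans (hwt1 j)))).2
      ⟨fun k => (hWk k).1, ?_⟩
    simp_rw [(hWk _).2]
    exact Summable.of_nonneg_of_le
      (fun k => mul_nonneg (norm_nonneg _) (Finset.prod_nonneg fun l _ => tsum_nonneg fun i => hv0 k l i))
      hcostk hmaj
  have hWsum : Summable (fun j : (Fin n × Fin 4 → ℤ) × (Fin n → ℕ ⊕ ℕ) => ‖W j‖) :=
    Summable.of_nonneg_of_le (fun j => norm_nonneg _)
      (fun j => le_mul_of_one_le_right (norm_nonneg _) (hwt1 j)) hWwsum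
  have hWtot : ∑' j, ‖W j‖ * wt j ≤ (2 * C₁ * B * U ^ 4) ^ n * M := by
    rw [hWwsum.tsum_prod]
    simp_rw [(hWk _).2]
    have hfin : Summable fun k : Fin n × Fin 4 → ℤ => ‖G k‖ * ∏ l, ∑' i, v k l i :=
      Summable.of_nonneg_of_le
        (fun k => mul_nonneg (norm_nonneg _) (Finset.prod_nonneg fun l _ => tsum_nonneg fun i => hv0 k l i))
        hcostk hmaj
    calc ∑' k, ‖G k‖ * ∏ l, ∑' i, v k l i ≤ ∑' k : Fin n × Fin 4 → ℤ, M * (2 * C₁ * B) ^ n * ∏ p, u (k p) :=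
          hfin.tsum_le_tsum hcostk hmaj
      _ = M * (2 * C₁ * B) ^ n * ∏ _p : Fin n × Fin 4, U := by
          rw [tsum_mul_left, (summable_prod_pi_of_nonneg (fun (_ : Fin n × Fin 4) m => u m) (fun _ m => hu0 m)
            (fun _ => hus)).2]
      _ = (2 * C₁ * B * U ^ 4) ^ n * M := by
          rw [Finset.prod_const, Finset.card_univ, Fintype.card_prod, Fintype.card_fin, Fintype.card_fin, pow_mul]
          ring
  -- (4) the expansion `F z = ∑_j W j β j z`
  -- slot values
  have hΘzero : ∀ (k : Fin n × Fin 4 → ℤ) (l : Fin n) (z : Fin n → EuclideanSpace ℝ (Fin 4)),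
      2 * ρ ≤ ‖z l - c l‖ →
      χ (ρ⁻¹ • (z l - c l)) • eChar (fun j => k (l, j)) ((4 : ℝ)⁻¹ • (ρ⁻¹ • (z l - c l)) + hhalf) = 0 :=
    fun k l z hz => slot_eq_zero_of_le χ hχout _ hhalf (c l) hρ (by linarith)
  have hχone : ∀ (z : Fin n → EuclideanSpace ℝ (Fin 4)), F z ≠ 0 → ∀ l, χ (ρ⁻¹ • (z l - c l)) = 1 := by
    intro z hz l
    refine χ.one_of_mem_closedBall ?_
    rw [hχin, Metric.mem_closedBall, dist_zero_right, norm_smul, norm_inv, Real.norm_of_nonneg hρ.le,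
      inv_mul_le_iff₀ hρ, mul_one]
    exact hsupp (subset_tsupport _ hz) l
  -- inner sums (over the atoms of the `n` slots)
  have hinner : ∀ (k : Fin n × Fin 4 → ℤ) (z : Fin n → EuclideanSpace ℝ (Fin 4)),
      HasSum (fun ι : Fin n → ℕ ⊕ ℕ => (∏ l, A k l (ι l)) * ((β (k, ι) z : ℝ) : ℂ))
        (∏ l, χ (ρ⁻¹ • (z l - c l)) • eChar (fun j => k (l, j)) ((4 : ℝ)⁻¹ • (ρ⁻¹ • (z l - c l)) + hhalf)) := by
    intro k z
    have hsl : ∀ l, Summable fun i => ‖A k l i * (b ((σ k l i)⁻¹ • (z l - η k l i)) : ℂ)‖ := by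
      intro l
      refine Summable.of_nonneg_of_le (fun _ => norm_nonneg _) (fun i => ?_) ((hAs k l).mul_right Bb)
      rw [norm_mul, Complex.norm_real, Real.norm_eq_abs]
      exact mul_le_mul_of_nonneg_left (hBb _) (norm_nonneg _)
    have h := hasSum_prod_pi (R := ℂ) (fun l i => A k l i * (b ((σ k l i)⁻¹ • (z l - η k l i)) : ℂ)) hsl
    have hval : ∀ l, ∑' i, A k l i * (b ((σ k l i)⁻¹ • (z l - η k l i)) : ℂ) =
        χ (ρ⁻¹ • (z l - c l)) • eChar (fun j => k (l, j)) ((4 : ℝ)⁻¹ • (ρ⁻¹ • (z l - c l)) + hhalf) :=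
      fun l => (hAsum k l (z l)).tsum_eq
    simp_rw [hval] at h
    refine h.congr_fun fun ι => ?_
    simp only [hβ, Complex.ofReal_prod, ← Finset.prod_mul_distrib]
  -- outer sums (over the frequencies)
  have houter : ∀ z : Fin n → EuclideanSpace ℝ (Fin 4),
      HasSum (fun k : Fin n × Fin 4 → ℤ => G k *
        ∏ l, χ (ρ⁻¹ • (z l - c l)) • eChar (fun j => k (l, j)) ((4 : ℝ)⁻¹ • (ρ⁻¹ • (z l - c l)) + hhalf))
        ((F z : ℝ) : ℂ) := by
    intro z
    by_cases hz : ∀ l, ‖z l - c l‖ < 2 * ρ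
    · set P : ℝ := ∏ l, χ (ρ⁻¹ • (z l - c l)) with hP
      have h := (hGexp z hz).mul_left (P : ℂ)
      have hPF : (P : ℂ) * ((F z : ℝ) : ℂ) = ((F z : ℝ) : ℂ) := by
        by_cases hFz : F z = 0
        · rw [hFz]; simp
        · have : P = 1 := by rw [hP]; exact Finset.prod_eq_one fun l _ => hχone z hFz l
          rw [this]; simp
      rw [hPF] at h
      refine h.congr_fun fun k => ?_
      simp only [Complex.real_smul, Finset.prod_mul_distrib, hP, Complex.ofReal_prod]
      ring
    · push Not at hz
      obtain ⟨l₀, hl₀⟩ := hz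
      have hFz : F z = 0 := by
        by_contra hne
        have := hsupp (subset_tsupport _ hne) l₀
        linarith
      have hterm : ∀ k : Fin n × Fin 4 → ℤ,
          G k * ∏ l, χ (ρ⁻¹ • (z l - c l)) • eChar (fun j => k (l, j)) ((4 : ℝ)⁻¹ • (ρ⁻¹ • (z l - c l)) + hhalf)
            = 0 := by
        intro k
        rw [Finset.prod_eq_zero (Finset.mem_univ l₀) (hΘzero k l₀ z hl₀), mul_zero]
      rw [hFz]
      simp only [hterm, Complex.ofReal_zero]
      exact hasSum_zero
  -- the expansion over `J`
  have hβbd : ∀ j z, |β j z| ≤ Bb ^ n := by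
    intro j z
    rw [hβ, Finset.abs_prod]
    calc ∏ l, |b ((σ j.1 l (j.2 l))⁻¹ • (z l - η j.1 l (j.2 l)))| ≤ ∏ _l : Fin n, Bb :=
          Finset.prod_le_prod (fun _ _ => abs_nonneg _) fun l _ => hBb _
      _ = Bb ^ n := by rw [Finset.prod_const, Finset.card_univ, Fintype.card_fin]
  have hexpJ : ∀ z : Fin n → EuclideanSpace ℝ (Fin 4),
      HasSum (fun j : (Fin n × Fin 4 → ℤ) × (Fin n → ℕ ⊕ ℕ) => W j * ((β j z : ℝ) : ℂ)) ((F z : ℝ) : ℂ) := by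
    intro z
    have hsW : Summable fun j : (Fin n × Fin 4 → ℤ) × (Fin n → ℕ ⊕ ℕ) => W j * ((β j z : ℝ) : ℂ) := by
      refine Summable.of_norm_bounded (hWsum.mul_right (Bb ^ n)) fun j => ?_
      rw [norm_mul, Complex.norm_real, Real.norm_eq_abs]
      exact mul_le_mul_of_nonneg_left (hβbd j z) (norm_nonneg _)
    have hfib : ∀ k : Fin n × Fin 4 → ℤ, HasSum (fun ι : Fin n → ℕ ⊕ ℕ => W (k, ι) * ((β (k, ι) z : ℝ) : ℂ))
        (G k * ∏ l, χ (ρ⁻¹ • (z l - c l)) • eChar (fun j => k (l, j)) ((4 : ℝ)⁻¹ • (ρ⁻¹ • (z l - c l)) + hhalf)) := by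
      intro k
      have h := (hinner k z).mul_left (G k)
      refine h.congr_fun fun ι => ?_
      simp only [hW]
      ring
    have h := hsW.hasSum
    rwa [← (h.prod_fiberwise hfib).unique (houter z)]
  -- (5) real parts and re-enumeration by `ℕ`
  haveI : Infinite (Fin n → ℕ ⊕ ℕ) := Pi.infinite_of_exists_right ⟨0, hn⟩
  obtain ⟨e⟩ : Nonempty (((Fin n × Fin 4 → ℤ) × (Fin n → ℕ ⊕ ℕ)) ≃ ℕ) := nonempty_equiv_of_countable
  refine ⟨fun i => (W (e.symm i)).re, fun i l => σ (e.symm i).1 l ((e.symm i).2 l),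
    fun i l => η (e.symm i).1 l ((e.symm i).2 l), ?_, ?_, ?_, fun i l => hgeo _ l _, fun z => ?_⟩
  · -- summability of the real parts
    have h := (e.symm.summable_iff (f := fun j => ‖W j‖)).2 hWsum
    refine Summable.of_nonneg_of_le (fun _ => abs_nonneg _) (fun i => ?_) h
    exact Complex.abs_re_le_norm _
  · -- weighted summability of the real parts
    have h := (e.symm.summable_iff (f := fun j => ‖W j‖ * wt j)).2 hWwsum
    refine Summable.of_nonneg_of_le (fun i => mul_nonneg (abs_nonneg _)
      (zero_le_one.trans (hwt1 (e.symm i)))) (fun i => ?_) h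
    exact mul_le_mul_of_nonneg_right (Complex.abs_re_le_norm _) (zero_le_one.trans (hwt1 (e.symm i)))
  · -- the weighted mass bound
    have h := (e.symm.summable_iff (f := fun j => ‖W j‖ * wt j)).2 hWwsum
    have hle : ∀ i, |(W (e.symm i)).re| * wt (e.symm i) ≤ ‖W (e.symm i)‖ * wt (e.symm i) := fun i =>
      mul_le_mul_of_nonneg_right (Complex.abs_re_le_norm _) (zero_le_one.trans (hwt1 (e.symm i)))
    calc ∑' i, |(W (e.symm i)).re| * ∏ l, (ρ / σ (e.symm i).1 l ((e.symm i).2 l)) ^ K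
        = ∑' i, |(W (e.symm i)).re| * wt (e.symm i) := rfl
      _ ≤ ∑' i, ‖W (e.symm i)‖ * wt (e.symm i) :=
          Summable.tsum_le_tsum hle (Summable.of_nonneg_of_le (fun i => mul_nonneg (abs_nonneg _)
            (zero_le_one.trans (hwt1 (e.symm i)))) hle h) h
      _ = ∑' j, ‖W j‖ * wt j := e.symm.tsum_eq (fun j => ‖W j‖ * wt j)
      _ ≤ (2 * C₁ * B * U ^ 4) ^ n * M := hWtot
  · -- the representation
    have h1 : HasSum (fun j : (Fin n × Fin 4 → ℤ) × (Fin n → ℕ ⊕ ℕ) => Complex.reCLM (W j * ((β j z : ℝ) : ℂ)))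
        (Complex.reCLM ((F z : ℝ) : ℂ)) := Complex.reCLM.hasSum (hexpJ z)
    have h2 : HasSum (fun j : (Fin n × Fin 4 → ℤ) × (Fin n → ℕ ⊕ ℕ) => (W j).re * β j z) (F z) := by
      simp only [Complex.reCLM_apply, Complex.mul_re, Complex.ofReal_re, Complex.ofReal_im, mul_zero,
        sub_zero] at h1
      exact h1
    have h3 := (e.symm.hasSum_iff (f := fun j => (W j).re * β j z)).2 h2
    simp only [hβ, Function.comp_def] at h3
    exact (h3.tsum_eq).symm

/-! ## §3 Weighted atomic synthesis on `(ℝ⁴)ⁿ` -/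

/-- ★ **Weighted atomic synthesis** (crux 28126 `AtomicSynthesis` PLUS the weighted mass): for every compactly
supported Schwartz bump `b` on `ℝ⁴` with `∫ b ≠ 0` and every weight exponent `K` there are `C, N` such that for all
`n ≥ 1` every Schwartz `F` on `(ℝ⁴)ⁿ` supported in a product of balls `B(c_l, ρ)` with `ρ^m‖D^m F‖_∞ ≤ M` (`m ≤ N·n`)
is an absolutely convergent series `Σ_i coef_i ∏_l b((z_l − η_il)/σ_il)` of tensor atoms of sizes `σ_il ≤ ρ` centred
within `2ρ` of `c_l`, with `Σ_i |coef_i| ∏_l (ρ/σ_il)^K ≤ Cⁿ·M` — small atoms are paid for polynomially.  This is the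
synthesis input of the tempered E3T. [folklore] -/
theorem atomicSynthesisW (b : SchwartzMap (EuclideanSpace ℝ (Fin 4)) ℝ) (hb : HasCompactSupport b)
    (hI : (∫ y, b y) ≠ 0) (K : ℕ) :
    ∃ (C : ℝ) (N : ℕ), 0 ≤ C ∧ ∀ (n : ℕ), 1 ≤ n →
      ∀ (F : SchwartzMap (Fin n → EuclideanSpace ℝ (Fin 4)) ℝ) (c : Fin n → EuclideanSpace ℝ (Fin 4))
        (ρ M : ℝ), 0 < ρ → tsupport F ⊆ {z | ∀ l, ‖z l - c l‖ ≤ ρ} →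
        (∀ m : ℕ, m ≤ N * n → ∀ z, ‖iteratedFDeriv ℝ m F z‖ ≤ M / ρ ^ m) →
        ∃ (coef : ℕ → ℝ) (σ : ℕ → Fin n → ℝ) (η : ℕ → Fin n → EuclideanSpace ℝ (Fin 4)),
          Summable (fun i => |coef i|) ∧ Summable (fun i => |coef i| * ∏ l, (ρ / σ i l) ^ K) ∧
          ∑' i, |coef i| * ∏ l, (ρ / σ i l) ^ K ≤ C ^ n * M ∧
          (∀ i l, 0 < σ i l ∧ σ i l ≤ ρ ∧ ‖η i l - c l‖ ≤ 2 * ρ) ∧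
          ∀ z, F z = ∑' i, coef i * ∏ l, b ((σ i l)⁻¹ • (z l - η i l)) := by
  obtain ⟨C₁, N₁, hC₁, hS⟩ := slotSynthW_exists b hb hI K
  exact synthW_of_slotSynthW b C₁ N₁ K hC₁ hS

end Summit.QuantumFields.YangMills.Theorems.AtomicSynthesisWeighted

end
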